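import Summits.Parity.GeneralizedHardyLittlewood.Theorems.LeeYangFibresAbsoluteUpgradeSinglesDecayCases
import Summits.Parity.GeneralizedHardyLittlewood.Theorems.LeeYangFibresAbsoluteUpgradeSinglesDecayPrep
import Summits.Parity.GeneralizedHardyLittlewood.Theorems.LeeYangFibresAbsoluteUpgradeSinglesDecayRemainder
import Summits.Parity.GeneralizedHardyLittlewood.Theorems.LeeYangFibresAbsoluteUpgradeSinglesDecayThresholds
import Summits.Parity.GeneralizedHardyLittlewood.Theorems.LeeYangFibresAbsoluteUpgradeClipCellsWalsh
import Literature.NumberTheory.Sieve.SieveFrameworkFundamentalLemma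
import Literature.NumberTheory.Sieve.LinearEquationsInPrimesSubsystems
import Literature.NumberTheory.Sieve.LinearEquationsInPrimesCountSandwich
import Literature.NumberTheory.Sieve.PolynomialValuesSieveBounds
import HarnessLib

/-!
# Route `LeeYangFibres`, crux `AbsoluteUpgrade` (stmt-Parity-14116), line `nlc-cells-absolute-clip`:
# the stub `SinglesDecay` — one-scale estimates (helper file 10)

The single-form parity marginals of the rough tuples of a one-dimensional system are sieve-visible
with an exponential rate in the roughness `u`.  This file proves the two ONE-SCALE estimates from
which the registered stub `stub_singlesDecay : SinglesDecay` is assembled (file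
`Theorems/LeeYangFibresAbsoluteUpgradeSinglesDecay.lean`, same lead):

* `singles_largeU` — for `z = ⌊N^{1/u}⌋ + 1 ≤ D = N^{1/8}` (the regime `u ≥ 17`): split the rough
  points of the interval `I` of positive lattice points of `K` by the sign of `λ(ψ_i(m))`, sift both
  sign classes of the values of `F_Ψ = ∏_k ψ_k` by the primes `< z` (Fundamental Lemma, dimension
  `2(L+t)`, the two main terms cancel: `signed_sifted_sum_le`), bound `V(z) ≤ 2 ∏_p β_p (u/log N)^t`
  and `e^{-log D/log z} ≤ e^{-u/16}`; the remainder (Liouville class sums) is kept abstract (`Rem`).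
* `singles_smallU` — for `4 ≤ u ≤ 16`: the trivial bound by the NUMBER of `N^{1/17}`-sifted points
  (`sifted_card_le`), `≤ 2(1 + C_FL) β_∞ ∏_p β_p (17/log N)^t + (1 + C_FL) + Rem`.

All sieve engines are landed helper files 1–9 of the previous lead (`…SinglesDecaySeq`, `…AP`,
`…Local`, `…Weights`, `…Remainder`, `…Dict`, `…Cases`, `…Prep`, `…Thresholds`) and the tree's
Fundamental Lemma `SieveSequence.fundamental_lemma_uniform_holds`; `V(z) ≤ 1` is the tree's
`Literature.NumberTheory.Sieve.prod_one_sub_rootCount_le_one`.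

References: J. Friedlander, H. Iwaniec, *Opera de Cribro* (2010), Cor. 6.10
[FriedlanderIwaniecOpera2010]; H. Halberstam, H.-E. Richert, *Sieve Methods* (1974), Thm. 2.5
[HalberstamRichert1974]; B. Green, T. Tao, Ann. of Math. 171 (2010), §1 [GreenTao2010].
-/

noncomputable section

open Finset Polynomial ArithmeticFunction Filter

namespace Summit.Parity.GeneralizedHardyLittlewood.Theorems.AbsoluteUpgrade

open Literature.NumberTheory.Sieve
open Summit.Parity.GeneralizedHardyLittlewood.Cruxes.AbsoluteUpgrade.NlcCellsAbsoluteClip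

variable {t : ℕ}

/-! ### Small facts -/

/-- `|λ(n)| ≤ 1` (`λ(0) = 0`). [folklore] -/
theorem abs_liouville_le_one : ∀ n : ℕ, |(liouville n : ℝ)| ≤ 1 := by
  intro n
  rcases eq_or_ne n 0 with rfl | hn
  · simp
  · rcases liouville_eq_one_or_eq_neg_one hn with h | h <;> simp [h]

/-- `∑_{d ≤ D sqfree} ω_F(d) ≤ ∑_{d ≤ D sqfree} ∑_{s mod d root} (1 + |…|)` (each root contributes at
least `1`). [folklore] -/
theorem sum_rootCount_le_classSums (F : ℤ[X]) (Dn : ℕ) (g : ℕ → ℕ → ℝ) (hg : ∀ d s, 0 ≤ g d s) :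
    ∑ d ∈ (Icc 1 Dn).filter Squarefree, (polyRootCountMod ![F] d : ℝ) ≤
      ∑ d ∈ (Icc 1 Dn).filter Squarefree, ∑ s ∈ rootsMod F d, (1 + g d s) := by
  refine Finset.sum_le_sum fun d _ => ?_
  rw [← card_rootsMod]
  calc ((#(rootsMod F d) : ℕ) : ℝ) = ∑ _s ∈ rootsMod F d, (1 : ℝ) := by simp
    _ ≤ ∑ s ∈ rootsMod F d, (1 + g d s) := Finset.sum_le_sum fun s _ => by linarith [hg d s]

/-- The lattice point `(m)` of `[-N, N]¹`. [folklore] -/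
theorem const_mem_latticeBox {N : ℕ} {m : ℤ} (hm : m ∈ Icc (-(N : ℤ)) N) :
    (fun _ : Fin 1 => m) ∈ latticeBox 1 N :=
  Fintype.mem_piFinset.mpr fun _ => hm

/-! ### The regime `z ≤ D`: the Fundamental Lemma with cancelling main terms -/

/-- **One-scale singles bound, sieving regime** (`z = ⌊N^{1/u}⌋ + 1 ≤ D = N^{1/8}`).  For a
non-degenerate `Ψ` with `|a_k| ≤ L` and no local obstruction, an integer interval `I = [m₁, m₂]` on
which every form is `≥ 1`, with `#I ≤ β_∞ + 1`, and roughness `N^{1/u} ≥ 2` with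
`⌊N^{1/u}⌋ ≥ max(L, 4t², 1)`:
`|∑_{m ∈ I, all ψ_k(m) rough} λ(ψ_i(m))| ≤ t + 2 C_FL e^{-u/16} β_∞ ∏_p β_p (u/log N)^t + C_FL + Rem`,
`Rem` any bound for the Liouville class sums `∑_{d ≤ D sqfree} ∑_{s root mod d} (1 + |∑_{m ≡ s} λ(ψ_i(m))|)`.
[cite: FriedlanderIwaniecOpera2010, Cor. 6.10] -/
theorem singles_largeU {κ Kd CFL : ℝ} (hCFL0 : 0 ≤ CFL)
    (hFL : ∀ A : SieveSequence, HasSieveDimension A.density κ Kd →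
      ∀ x z D : ℝ, 2 ≤ z → z ≤ D → 0 ≤ A.size x →
        |A.sifted x (primesProdBelow z) - A.size x * A.densityProduct (primesProdBelow z)| ≤
          CFL * A.size x * A.densityProduct (primesProdBelow z) *
              Real.exp (-(Real.log D / Real.log z)) +
            ∑ d ∈ (primesProdBelow z).divisors.filter (fun d : ℕ => (d : ℝ) ≤ D),
              |A.remainder d x|)
    {Ψ : Fin t → AffLinForm 1} (hΨ : IsNondegenerateSystem Ψ) {L : ℕ}
    (haL : ∀ k, ((Ψ k).coeff 0).natAbs ≤ L)
    (hdim : HasSieveDimension (rootDensity (sysPoly Ψ)) κ Kd)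
    {m₁ m₂ : ℤ} (hI : ∀ m ∈ Icc m₁ m₂, ∀ k, 1 ≤ (Ψ k).eval (fun _ => m))
    {AF : ℝ} (hAF : 0 ≤ AF) (hcard : (#(Icc m₁ m₂) : ℝ) ≤ AF + 1)
    {N u : ℕ} (hu : 1 ≤ u) (hy2 : (2 : ℝ) ≤ (N : ℝ) ^ ((1 : ℝ) / u))
    (hhead : L ≤ ⌊(N : ℝ) ^ ((1 : ℝ) / u)⌋₊ ∧ 4 * t ^ 2 ≤ ⌊(N : ℝ) ^ ((1 : ℝ) / u)⌋₊ ∧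
      1 ≤ ⌊(N : ℝ) ^ ((1 : ℝ) / u)⌋₊)
    (hzD : (((⌊(N : ℝ) ^ ((1 : ℝ) / u)⌋₊ + 1 : ℕ) : ℝ)) ≤ (N : ℝ) ^ ((1 : ℝ) / 8))
    (i : Fin t) {Rem : ℝ}
    (hRem : ∑ d ∈ (Icc 1 ⌊(N : ℝ) ^ ((1 : ℝ) / 8)⌋₊).filter Squarefree,
      ∑ s ∈ rootsMod (sysPoly Ψ) d,
        (1 + |∑ m ∈ (Icc m₁ m₂).filter (fun m : ℤ => m ≡ (s : ℤ) [ZMOD d]),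
          (liouville ((Ψ i).coeff 0 * m + (Ψ i).const).toNat : ℝ)|) ≤ Rem) :
    |∑ m ∈ (Icc m₁ m₂).filter (fun m : ℤ => ∀ k, (N : ℝ) ^ ((1 : ℝ) / u) <
        (Nat.minFac ((Ψ k).eval (fun _ => m)).toNat : ℝ)),
      (liouville ((Ψ i).coeff 0 * m + (Ψ i).const).toNat : ℝ)| ≤
      t + (2 * CFL * Real.exp (-((1 : ℝ) / 16 * u)) * (AF * singularProduct Ψ) *
        ((u : ℝ) / Real.log N) ^ t + CFL) + Rem := by
  set y : ℝ := (N : ℝ) ^ ((1 : ℝ) / u) with hy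
  set z : ℝ := ((⌊y⌋₊ + 1 : ℕ) : ℝ) with hz
  set D : ℝ := (N : ℝ) ^ ((1 : ℝ) / 8) with hD
  set a : ℤ := (Ψ i).coeff 0 with ha
  set b : ℤ := (Ψ i).const with hb
  set F := sysPoly Ψ with hF
  have hy1 : (1 : ℝ) ≤ y := by linarith
  have hy0 : (0 : ℝ) ≤ y := by linarith
  have hyz : y < z := by rw [hz]; push_cast; exact Nat.lt_floor_add_one y
  have hz1 : (1 : ℝ) < z := lt_of_le_of_lt hy1 hyz
  have hz2 : (2 : ℝ) ≤ z := by
    rw [hz]; exact_mod_cast Nat.succ_le_succ hhead.2.2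
  have hceil : ⌈z⌉₊ - 1 = ⌊y⌋₊ := by rw [hz, Nat.ceil_natCast, Nat.add_sub_cancel]
  -- Step 1: rough points versus sifted points (differ by at most `t`)
  have hab : ∀ m ∈ Icc m₁ m₂, 1 ≤ a * m + b := fun m hm => by
    have := hI m hm i; rwa [DimOne.eval_eq] at this
  have h1 := abs_sum_rough_sub_sum_coprime_le hΨ hI hy1
    (fun m : ℤ => (liouville (a * m + b).toNat : ℝ)) (fun m => abs_liouville_le_one _)
  -- Step 2: the Fundamental Lemma on the two sign classes
  have hFpos : ∀ m ∈ Icc m₁ m₂, 0 < F.eval m ∧ ((F.eval m : ℤ) : ℝ) ≤ ∑ m' ∈ Icc m₁ m₂, ((F.eval m' : ℤ) : ℝ) := by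
    have hpos : ∀ m ∈ Icc m₁ m₂, 0 < F.eval m := fun m hm => by
      rw [hF, sysPoly_eval]
      exact Finset.prod_pos fun k _ => lt_of_lt_of_le zero_lt_one (hI m hm k)
    intro m hm
    refine ⟨hpos m hm, ?_⟩
    have h := Finset.single_le_sum (f := fun m' : ℤ => F.eval m') (fun m' hm' => (hpos m' hm').le) hm
    exact_mod_cast h
  have hzD' : z ≤ D := hzD
  have h2 := signed_sifted_sum_le hFL hdim hab hFpos hz2 hzD'
  -- Step 3: the main term
  have hV1 := prod_one_sub_rootCount_le_one F z
  have hV0 := prod_one_sub_rootCount_nonneg F z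
  have hW : 1 / Real.log z ≤ (u : ℝ) / Real.log N :=
    one_div_log_le hu (by rw [← hy]; linarith) hyz
  have hhead' : L ≤ ⌈z⌉₊ - 1 ∧ 4 * t ^ 2 ≤ ⌈z⌉₊ - 1 ∧ 1 ≤ ⌈z⌉₊ - 1 := by
    rw [hceil]; exact hhead
  have hV := prod_one_sub_rootCount_le_main hΨ haL hz1 hhead' hW
  have hzle : z ≤ 2 * y := by
    rw [hz]; push_cast
    linarith [Nat.floor_le hy0]
  have hE := exp_neg_le_exp_neg_div hu hy2 hz1 hzle
  have hE0 : 0 ≤ Real.exp (-(Real.log D / Real.log z)) := (Real.exp_pos _).le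
  have hE1 : Real.exp (-(Real.log D / Real.log z)) ≤ 1 := by
    rw [Real.exp_le_one_iff, neg_nonpos]
    refine div_nonneg ?_ (Real.log_pos hz1).le
    rw [hD]
    have hN1 : (1 : ℝ) ≤ N := by
      by_contra h
      push Not at h
      have hN0 : (0 : ℝ) ≤ N := Nat.cast_nonneg N
      have : y ≤ 1 := Real.rpow_le_one hN0 h.le (by positivity)
      linarith
    exact Real.log_nonneg (Real.one_le_rpow hN1 (by norm_num))
  have hSP : 0 ≤ singularProduct Ψ :=
    ge_of_tendsto' (tendsto_singularProductPartial_holds 1 t Ψ hΨ)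
      fun x => Finset.prod_nonneg fun p _ => localFactor_nonneg Ψ p
  have hWt : 0 ≤ ((u : ℝ) / Real.log N) ^ t := by
    have : 0 ≤ (u : ℝ) / Real.log N := le_trans (by have := Real.log_pos hz1; positivity) hW
    positivity
  have hmain := main_term_le hCFL0 hcard hAF hSP hWt hV0 hV1 hV hE0 hE1 hE
  -- Step 4: assemble
  have htri : |∑ m ∈ (Icc m₁ m₂).filter (fun m : ℤ => ∀ k, y < (Nat.minFac ((Ψ k).eval (fun _ => m)).toNat : ℝ)),
      (liouville (a * m + b).toNat : ℝ)| ≤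
      t + |∑ m ∈ (Icc m₁ m₂).filter (fun m : ℤ => (F.eval m).natAbs.Coprime (primesProdBelow z)),
        (liouville (a * m + b).toNat : ℝ)| := by
    have h1' : |∑ m ∈ (Icc m₁ m₂).filter (fun m : ℤ => ∀ k, y < (Nat.minFac ((Ψ k).eval (fun _ => m)).toNat : ℝ)),
        (liouville (a * m + b).toNat : ℝ) -
        ∑ m ∈ (Icc m₁ m₂).filter (fun m : ℤ => (F.eval m).natAbs.Coprime (primesProdBelow z)),
          (liouville (a * m + b).toNat : ℝ)| ≤ t := h1
    have := abs_sub_abs_le_abs_sub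
      (∑ m ∈ (Icc m₁ m₂).filter (fun m : ℤ => ∀ k, y < (Nat.minFac ((Ψ k).eval (fun _ => m)).toNat : ℝ)),
        (liouville (a * m + b).toNat : ℝ))
      (∑ m ∈ (Icc m₁ m₂).filter (fun m : ℤ => (F.eval m).natAbs.Coprime (primesProdBelow z)),
        (liouville (a * m + b).toNat : ℝ))
    linarith [h1']
  calc _ ≤ t + |∑ m ∈ (Icc m₁ m₂).filter (fun m : ℤ => (F.eval m).natAbs.Coprime (primesProdBelow z)),
        (liouville (a * m + b).toNat : ℝ)| := htri
    _ ≤ t + (CFL * #(Icc m₁ m₂) * (∏ p ∈ Nat.primesBelow ⌈z⌉₊, (1 - (polyRootCountMod ![F] p : ℝ) / p)) *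
          Real.exp (-(Real.log D / Real.log z)) + Rem) := by
        have := h2.trans (add_le_add le_rfl hRem)
        linarith
    _ ≤ _ := by linarith [hmain]

/-! ### The regime of small roughness: the number of `N^{1/17}`-sifted points -/

/-- **One-scale singles bound, small roughness** (`u ≤ 16`, sieve at `z' = ⌊N^{1/17}⌋ + 1 ≤ D`).
With the data of `singles_largeU` at the threshold `N^{1/17}` instead of `N^{1/u}`:
`|∑_{m ∈ I, all ψ_k(m) N^{1/u}-rough} λ(ψ_i(m))| ≤ #{m ∈ I : (F_Ψ(m), P(z')) = 1}
  ≤ 2 (1 + C_FL) β_∞ ∏_p β_p (17/log N)^t + (1 + C_FL) + Rem`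
(the `N^{1/u}`-rough points are `N^{1/17}`-rough, hence sifted; upper-bound sieve `sifted_card_le`;
`∑_{d ≤ D} ω(d) ≤ Rem`). [cite: HalberstamRichert1974, Thm. 2.5] -/
theorem singles_smallU {κ Kd CFL : ℝ} (hCFL0 : 0 ≤ CFL)
    (hFL : ∀ A : SieveSequence, HasSieveDimension A.density κ Kd →
      ∀ x z D : ℝ, 2 ≤ z → z ≤ D → 0 ≤ A.size x →
        |A.sifted x (primesProdBelow z) - A.size x * A.densityProduct (primesProdBelow z)| ≤
          CFL * A.size x * A.densityProduct (primesProdBelow z) *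
              Real.exp (-(Real.log D / Real.log z)) +
            ∑ d ∈ (primesProdBelow z).divisors.filter (fun d : ℕ => (d : ℝ) ≤ D),
              |A.remainder d x|)
    {Ψ : Fin t → AffLinForm 1} (hΨ : IsNondegenerateSystem Ψ) {L : ℕ}
    (haL : ∀ k, ((Ψ k).coeff 0).natAbs ≤ L)
    (hdim : HasSieveDimension (rootDensity (sysPoly Ψ)) κ Kd)
    {m₁ m₂ : ℤ} (hI : ∀ m ∈ Icc m₁ m₂, ∀ k, 1 ≤ (Ψ k).eval (fun _ => m))
    {AF : ℝ} (hAF : 0 ≤ AF) (hcard : (#(Icc m₁ m₂) : ℝ) ≤ AF + 1)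
    {N u : ℕ} (hu : 1 ≤ u) (hu16 : u ≤ 16) (hN1 : (1 : ℝ) ≤ N)
    (hy2 : (2 : ℝ) ≤ (N : ℝ) ^ ((1 : ℝ) / 17))
    (hhead : L ≤ ⌊(N : ℝ) ^ ((1 : ℝ) / 17)⌋₊ ∧ 4 * t ^ 2 ≤ ⌊(N : ℝ) ^ ((1 : ℝ) / 17)⌋₊ ∧
      1 ≤ ⌊(N : ℝ) ^ ((1 : ℝ) / 17)⌋₊)
    (hzD : (((⌊(N : ℝ) ^ ((1 : ℝ) / 17)⌋₊ + 1 : ℕ) : ℝ)) ≤ (N : ℝ) ^ ((1 : ℝ) / 8))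
    (i : Fin t) {Rem : ℝ}
    (hRem : ∑ d ∈ (Icc 1 ⌊(N : ℝ) ^ ((1 : ℝ) / 8)⌋₊).filter Squarefree,
      ∑ s ∈ rootsMod (sysPoly Ψ) d,
        (1 + |∑ m ∈ (Icc m₁ m₂).filter (fun m : ℤ => m ≡ (s : ℤ) [ZMOD d]),
          (liouville ((Ψ i).coeff 0 * m + (Ψ i).const).toNat : ℝ)|) ≤ Rem) :
    |∑ m ∈ (Icc m₁ m₂).filter (fun m : ℤ => ∀ k, (N : ℝ) ^ ((1 : ℝ) / u) <
        (Nat.minFac ((Ψ k).eval (fun _ => m)).toNat : ℝ)),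
      (liouville ((Ψ i).coeff 0 * m + (Ψ i).const).toNat : ℝ)| ≤
      (2 * (1 + CFL) * (AF * singularProduct Ψ) * ((17 : ℝ) / Real.log N) ^ t + (1 + CFL)) + Rem := by
  set y : ℝ := (N : ℝ) ^ ((1 : ℝ) / 17) with hy
  set z : ℝ := ((⌊y⌋₊ + 1 : ℕ) : ℝ) with hz
  set D : ℝ := (N : ℝ) ^ ((1 : ℝ) / 8) with hD
  set a : ℤ := (Ψ i).coeff 0 with ha
  set b : ℤ := (Ψ i).const with hb
  set F := sysPoly Ψ with hF
  have hy1 : (1 : ℝ) ≤ y := by linarith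
  have hy0 : (0 : ℝ) ≤ y := by linarith
  have hyz : y < z := by rw [hz]; push_cast; exact Nat.lt_floor_add_one y
  have hz1 : (1 : ℝ) < z := lt_of_le_of_lt hy1 hyz
  have hz2 : (2 : ℝ) ≤ z := by
    rw [hz]; exact_mod_cast Nat.succ_le_succ hhead.2.2
  have hceil : ⌈z⌉₊ - 1 = ⌊y⌋₊ := by rw [hz, Nat.ceil_natCast, Nat.add_sub_cancel]
  -- the `N^{1/u}`-rough points are `N^{1/17}`-rough, hence sifted
  have hyu : y ≤ (N : ℝ) ^ ((1 : ℝ) / u) := by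
    rw [hy]
    refine Real.rpow_le_rpow_of_exponent_le hN1 ?_
    have hu0 : (0 : ℝ) < u := by exact_mod_cast hu
    have hu16' : (u : ℝ) ≤ 16 := by exact_mod_cast hu16
    rw [div_le_div_iff₀ (by norm_num) hu0]
    linarith
  have hsub1 : (Icc m₁ m₂).filter (fun m : ℤ => ∀ k, (N : ℝ) ^ ((1 : ℝ) / u) <
      (Nat.minFac ((Ψ k).eval (fun _ => m)).toNat : ℝ)) ⊆
      (Icc m₁ m₂).filter (fun m : ℤ => ∀ k, y < (Nat.minFac ((Ψ k).eval (fun _ => m)).toNat : ℝ)) := by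
    intro m hm
    rw [Finset.mem_filter] at hm ⊢
    exact ⟨hm.1, fun k => lt_of_le_of_lt hyu (hm.2 k)⟩
  have hsub2 := (rough_subset_coprime Ψ hI hy1).1
  have hFpos : ∀ m ∈ Icc m₁ m₂, 0 < F.eval m ∧ ((F.eval m : ℤ) : ℝ) ≤ ∑ m' ∈ Icc m₁ m₂, ((F.eval m' : ℤ) : ℝ) := by
    have hpos : ∀ m ∈ Icc m₁ m₂, 0 < F.eval m := fun m hm => by
      rw [hF, sysPoly_eval]
      exact Finset.prod_pos fun k _ => lt_of_lt_of_le zero_lt_one (hI m hm k)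
    intro m hm
    refine ⟨hpos m hm, ?_⟩
    have h := Finset.single_le_sum (f := fun m' : ℤ => F.eval m') (fun m' hm' => (hpos m' hm').le) hm
    exact_mod_cast h
  have hzD' : z ≤ D := hzD
  have hcardle := sifted_card_le hCFL0 hFL hdim hFpos hz2 hzD'
  -- the sieve product
  have hV1 := prod_one_sub_rootCount_le_one F z
  have hV0 := prod_one_sub_rootCount_nonneg F z
  have hW : 1 / Real.log z ≤ (17 : ℝ) / Real.log N := by
    have e : (1 : ℝ) / ((17 : ℕ) : ℝ) = (1 : ℝ) / 17 := by norm_num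
    have h := one_div_log_le (N := N) (u := 17) (by norm_num) (by rw [e, ← hy]; linarith)
      (by rw [e, ← hy]; exact hyz)
    have e' : ((17 : ℕ) : ℝ) = 17 := by norm_num
    rwa [e'] at h
  have hhead' : L ≤ ⌈z⌉₊ - 1 ∧ 4 * t ^ 2 ≤ ⌈z⌉₊ - 1 ∧ 1 ≤ ⌈z⌉₊ - 1 := by
    rw [hceil]; exact hhead
  have hV := prod_one_sub_rootCount_le_main hΨ haL hz1 hhead' hW
  have hSP : 0 ≤ singularProduct Ψ :=
    ge_of_tendsto' (tendsto_singularProductPartial_holds 1 t Ψ hΨ)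
      fun x => Finset.prod_nonneg fun p _ => localFactor_nonneg Ψ p
  -- the remainder
  have hω : ∑ d ∈ (Icc 1 ⌊D⌋₊).filter Squarefree, (polyRootCountMod ![F] d : ℝ) ≤ Rem :=
    (sum_rootCount_le_classSums F ⌊D⌋₊
      (fun d s => |∑ m ∈ (Icc m₁ m₂).filter (fun m : ℤ => m ≡ (s : ℤ) [ZMOD d]), (liouville (a * m + b).toNat : ℝ)|)
      fun d s => abs_nonneg _).trans hRem
  -- assemble
  set V := ∏ p ∈ Nat.primesBelow ⌈z⌉₊, (1 - (polyRootCountMod ![F] p : ℝ) / p) with hVdef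
  have hIV : (1 + CFL) * (#(Icc m₁ m₂) : ℝ) * V ≤
      2 * (1 + CFL) * (AF * singularProduct Ψ) * ((17 : ℝ) / Real.log N) ^ t + (1 + CFL) := by
    have h1 : (1 + CFL) * (#(Icc m₁ m₂) : ℝ) * V ≤ (1 + CFL) * (AF + 1) * V := by
      have := mul_le_mul_of_nonneg_left hcard (show 0 ≤ 1 + CFL by positivity)
      exact mul_le_mul_of_nonneg_right this hV0
    have h2 : (1 + CFL) * AF * V ≤ (1 + CFL) * AF * (2 * singularProduct Ψ * ((17 : ℝ) / Real.log N) ^ t) :=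
      mul_le_mul_of_nonneg_left hV (by positivity)
    have h3 : (1 + CFL) * V ≤ (1 + CFL) := mul_le_of_le_one_right (by positivity) hV1
    have e : (1 + CFL) * (AF + 1) * V = (1 + CFL) * AF * V + (1 + CFL) * V := by ring
    rw [e] at h1
    linarith
  calc |∑ m ∈ (Icc m₁ m₂).filter (fun m : ℤ => ∀ k, (N : ℝ) ^ ((1 : ℝ) / u) <
          (Nat.minFac ((Ψ k).eval (fun _ => m)).toNat : ℝ)), (liouville (a * m + b).toNat : ℝ)|
      ≤ ∑ m ∈ (Icc m₁ m₂).filter (fun m : ℤ => ∀ k, (N : ℝ) ^ ((1 : ℝ) / u) <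
          (Nat.minFac ((Ψ k).eval (fun _ => m)).toNat : ℝ)), |(liouville (a * m + b).toNat : ℝ)| :=
        Finset.abs_sum_le_sum_abs _ _
    _ ≤ ∑ _m ∈ (Icc m₁ m₂).filter (fun m : ℤ => ∀ k, (N : ℝ) ^ ((1 : ℝ) / u) <
          (Nat.minFac ((Ψ k).eval (fun _ => m)).toNat : ℝ)), (1 : ℝ) :=
        Finset.sum_le_sum fun m _ => abs_liouville_le_one _
    _ = #((Icc m₁ m₂).filter (fun m : ℤ => ∀ k, (N : ℝ) ^ ((1 : ℝ) / u) <
          (Nat.minFac ((Ψ k).eval (fun _ => m)).toNat : ℝ))) := by simp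
    _ ≤ #((Icc m₁ m₂).filter (fun m : ℤ => (F.eval m).natAbs.Coprime (primesProdBelow z))) := by
        exact_mod_cast Finset.card_le_card (hsub1.trans hsub2)
    _ ≤ (1 + CFL) * #(Icc m₁ m₂) * V + ∑ d ∈ (Icc 1 ⌊D⌋₊).filter Squarefree, (polyRootCountMod ![F] d : ℝ) :=
        hcardle
    _ ≤ _ := by linarith

end Summit.Parity.GeneralizedHardyLittlewood.Theorems.AbsoluteUpgrade

end
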